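import Literature.Probability.Process.ProgressiveDensity
import HarnessLib

/-!
# Density of bounded simple processes below a given bound

A complement to `ProgressiveDensity`: for a progressive integrand `H` which is **uniformly bounded,
`|H| ≤ M`**, the approximating bounded simple processes `Hₙ → H` in `L²(ds ⊗ μ)` on every `[0, t]`
can be chosen with values **bounded by the same `M`** (`exists_tendsto_approxErr_of_bdd`).  The
construction is that of `exists_simpleProcess_approxErr_le` without the truncation step: average
over a short past window (`timeAvg`, values stay in `[-M, M]`), then sample on a dyadic grid
(`SimpleProcess.sample`, whose clamp does not bite below `M`).  The uniform bound is what moment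
estimates for the stochastic integral `∫ H dB` of a bounded integrand need when passing to the
limit along the approximants (Fatou).

## References

* D. Revuz, M. Yor, *Continuous Martingales and Brownian Motion* (3rd ed., 1999), Ch. IV,
  Prop. (2.8) (density of elementary processes in `L²(M)`); I. Karatzas, S. Shreve, *Brownian
  Motion and Stochastic Calculus* (1991), Lemma 3.2.4 (bounded progressive integrands are limits
  of simple ones bounded by the same constant).
-/

open MeasureTheory ProbabilityTheory Filter Finset
open scoped NNReal ENNReal Topology

noncomputable section

namespace Literature.Probability.Process

variable {Ω : Type*} {m : MeasurableSpace Ω} {𝓕 : Filtration ℝ≥0 m} {μ : Measure Ω}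
  [IsFiniteMeasure μ] {H : ℝ≥0 → Ω → ℝ} {M : ℝ}

/-- **Bounded simple approximation below the bound (ε-form)**: for a progressive `H` with
`|H| ≤ M` and `ε > 0` there is a bounded simple process `S` with values in `[-M, M]` and
`E ∫₀ᵀ (S - H)² ≤ ε`.
[cite: RevuzYor1999, Ch. IV Prop. (2.8) (density of elementary processes; bounded case as in Karatzas–Shreve Lemma 3.2.4)] -/
theorem exists_simpleProcess_approxErr_le_of_bdd (hH : IsStronglyProgressive 𝓕 H)
    (hM : ∀ s ω, |H s ω| ≤ M) (T : ℝ≥0) {ε : ℝ≥0∞} (hε : 0 < ε) :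
    ∃ S : SimpleProcess m 𝓕, (∀ i ω, |S.value i ω| ≤ M) ∧ S.approxErr H μ T ≤ ε := by
  have hHm := measurable_toNNReal_of_isStronglyProgressive hH
  -- the error budget `δ = ε / 4`
  set δ : ℝ≥0∞ := ε / 4 with hδ
  have hδpos : 0 < δ := ENNReal.div_pos hε.ne' (by norm_num)
  have hδε : 2 * δ + 2 * δ = ε := by
    rw [hδ]
    have : 2 * (ε / 4) + 2 * (ε / 4) = 4 * (ε / 4) := by ring
    rw [this, ENNReal.mul_div_cancel (by norm_num) (by norm_num)]
  -- Step 1: averaging window `1/(n+1)`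
  obtain ⟨n, hn⟩ := (eventually_atTop.1
    ((ENNReal.tendsto_nhds_zero.1 (tendsto_sqErr_timeAvg (μ := μ) hH hM T)) δ hδpos))
  have hn' := hn n le_rfl
  set A : ℝ≥0 → Ω → ℝ := timeAvg H n with hA
  have hAa : Adapted 𝓕 A := adapted_timeAvg hH n
  have hAm : Measurable fun p : Ω × ℝ ↦ A p.2.toNNReal p.1 := measurable_timeAvg_toNNReal hH hM n
  have hAc : ∀ ω, Continuous (A · ω) := fun ω ↦
    continuous_timeAvg (measurable_path_of_measurable_toNNReal hHm ω) (fun s ↦ hM s ω) n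
  have hAbdd : ∀ s ω, |A s ω| ≤ M := fun s ω ↦ abs_timeAvg_le hM n s ω
  -- Step 2: sampling mesh `2⁻ʲ`
  obtain ⟨j, hj⟩ := (eventually_atTop.1
    ((ENNReal.tendsto_nhds_zero.1 (tendsto_approxErr_sample (μ := μ) hAa hAc hAm hAbdd T)) δ hδpos))
  have hj' := hj j le_rfl
  refine ⟨SimpleProcess.sample A hAa j, fun i ω ↦ ?_, ?_⟩
  · rw [SimpleProcess.sample_value]
    exact (abs_clamp_le_abs (Nat.cast_nonneg j) _).trans (hAbdd _ ω)
  -- combine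
  have hSm : Measurable fun p : Ω × ℝ ↦ (SimpleProcess.sample A hAa j).toProcess p.2.toNNReal p.1 :=
    (SimpleProcess.sample A hAa j).measurable_toProcess_prod
  rw [SimpleProcess.approxErr_eq_sqErr] at hj' ⊢
  calc sqErr (SimpleProcess.sample A hAa j).toProcess H μ T
      ≤ 2 * sqErr (SimpleProcess.sample A hAa j).toProcess A μ T + 2 * sqErr A H μ T :=
        sqErr_le_two_mul_add hSm hAm hHm T
    _ ≤ 2 * δ + 2 * δ := by gcongr
    _ = ε := hδε

/-- **Bounded simple approximation below the bound (sequence form)**: for a progressive `H` with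
`|H| ≤ M` there are bounded simple processes `Hₙ` with values in `[-M, M]` and
`E ∫₀ᵗ (Hₙ - H)² → 0` for every `t`; in particular `Hₙ` is an approximating sequence of `H`
(`SimpleProcess.IsApproxSeq`).
[cite: RevuzYor1999, Ch. IV Prop. (2.8) (density of elementary processes; bounded case as in Karatzas–Shreve Lemma 3.2.4)] -/
theorem exists_tendsto_approxErr_of_bdd (hH : IsStronglyProgressive 𝓕 H) (hM : ∀ s ω, |H s ω| ≤ M) :
    ∃ Hn : ℕ → SimpleProcess m 𝓕, (∀ n i ω, |(Hn n).value i ω| ≤ M) ∧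
      (∀ t : ℝ≥0, Tendsto (fun n ↦ (Hn n).approxErr H μ t) atTop (𝓝 0)) ∧
      SimpleProcess.IsApproxSeq Hn H μ := by
  have hε : ∀ n : ℕ, (0 : ℝ≥0∞) < ((n : ℝ≥0∞) + 1)⁻¹ := fun n ↦
    ENNReal.inv_pos.2 (by simp)
  choose S hSb hS using fun n : ℕ ↦
    exists_simpleProcess_approxErr_le_of_bdd (μ := μ) hH hM (n : ℝ≥0) (hε n)
  have hlim : ∀ t : ℝ≥0, Tendsto (fun n ↦ (S n).approxErr H μ t) atTop (𝓝 0) := by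
    intro t
    have h0 : Tendsto (fun n : ℕ ↦ ((n : ℝ≥0∞) + 1)⁻¹) atTop (𝓝 0) := by
      have h := ENNReal.tendsto_inv_nat_nhds_zero.comp (tendsto_add_atTop_nat 1)
      refine h.congr fun n ↦ ?_
      simp [Function.comp_apply, Nat.cast_succ]
    refine tendsto_of_tendsto_of_tendsto_of_le_of_le' tendsto_const_nhds h0
      (Eventually.of_forall fun n ↦ bot_le) ?_
    filter_upwards [eventually_ge_atTop ⌈(t : ℝ)⌉₊] with n hn
    have hnt : t ≤ (n : ℝ≥0) := by
      rw [← NNReal.coe_le_coe]; push_cast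
      exact (Nat.le_ceil _).trans (by exact_mod_cast hn)
    exact (sqErr_mono _ _ _ hnt).trans (hS n)
  exact ⟨S, hSb, hlim, SimpleProcess.isApproxSeq_of_tendsto_approxErr
    (measurable_toNNReal_of_isStronglyProgressive hH) hlim⟩

end Literature.Probability.Process

end
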